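import Literature.Probability.Percolation.BoxCrossingUpperBound
import Literature.Probability.Percolation.Z2HalfPlaneThreeArm

/-!
# Stub `stub_boundaryArmTightness`, assembly input I: lattice sectors inside standard sectors,
# and discrete-arc membership next to a boundary ray
# (line `excursion-kernel-covariance`, crux `RectilinearCardy`, stmt-CriticalPhenomena-5660)

Frame bookkeeping between the lattice sector walks (standard orientation, integer thresholds) and
the standard sectors of the wedge at a boundary point `b` (frame `u = (z - b)(-i)^n`):

* `inSec_real_mul_iff`: the standard sectors are cones;
* `inSec_of_latticeSector`: a lattice point `(p, q)` beyond the integer thresholds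
  `⌊β.re⌋ + 1`, `⌊β.im⌋ + 1` (resp. below `⌈β.re⌉ - 1`) lies, seen from `β`, in the standard
  sector; `inSec_convexComb_of_latticeSector`: so does the whole unit step between two such
  adjacent lattice points (for three quadrants, an adjacent pair cannot straddle the two pieces);
* `frame_convexComb`: the frame map is affine;
* `mem_discreteArc_of_frame`: **a vertex of `Ω_δ` just beside a boundary ray belongs to the
  discrete arc of any boundary set containing that ray beyond distance `λ` from `b` and whose
  complement near `b` lies on the closed half-plane behind `b` or within `λ` of `b`** (closest-arc
  rule: the foot of the vertex on the ray is within `δ`, everything else is farther).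
-/

noncomputable section

open Set Filter Topology MeasureTheory Metric
open Literature.Probability.Percolation
open Literature.Probability.LatticeModels (Site zdGraph meshPoint meshDomain meshBoundary discreteArc
  meshVertices)

namespace Summit.CriticalPhenomena.CardyFormulaZ2.Cruxes.RectilinearCardy.ExcursionKernelCovariance

/-! ### Standard sectors are cones -/

/-- The standard sector of `m` quadrants is invariant under positive real scaling. [folklore] -/
theorem inSec_real_mul_iff (m : ℕ) {δ : ℝ} (hδ : 0 < δ) (v : ℂ) :
    ((m = 1 → 0 < ((δ : ℂ) * v).re ∧ 0 < ((δ : ℂ) * v).im) ∧ (m = 2 → 0 < ((δ : ℂ) * v).im) ∧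
      (m = 3 → 0 < ((δ : ℂ) * v).im ∨ ((δ : ℂ) * v).re < 0)) ↔
    ((m = 1 → 0 < v.re ∧ 0 < v.im) ∧ (m = 2 → 0 < v.im) ∧ (m = 3 → 0 < v.im ∨ v.re < 0)) := by
  have hre : ((δ : ℂ) * v).re = δ * v.re := by simp
  have him : ((δ : ℂ) * v).im = δ * v.im := by simp
  rw [hre, him]
  have h1 : 0 < δ * v.re ↔ 0 < v.re := mul_pos_iff_of_pos_left hδ
  have h2 : 0 < δ * v.im ↔ 0 < v.im := mul_pos_iff_of_pos_left hδ
  have h3 : δ * v.re < 0 ↔ v.re < 0 := by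
    constructor
    · intro h; by_contra h'; push Not at h'; nlinarith
    · intro h; nlinarith
  rw [h1, h2, h3]

/-! ### Lattice sectors lie in standard sectors -/

/-- **A lattice point of the lattice sector lies in the standard sector seen from `β`.** With the
thresholds `x₀ = ⌊β.re⌋ + 1`, `y₀ = ⌊β.im⌋ + 1`, `x₁ = ⌈β.re⌉ - 1`: a lattice point `(p, q)` with
`p ≥ x₀, q ≥ y₀` (one quadrant), `q ≥ y₀` (two), `q ≥ y₀` or `p ≤ x₁` (three) satisfies the
corresponding strict inequalities relative to `β`. [folklore] -/
theorem inSec_of_latticeSector (m : ℕ) (β : ℂ) (p q : ℤ)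
    (h : (m = 1 → ⌊β.re⌋ + 1 ≤ p ∧ ⌊β.im⌋ + 1 ≤ q) ∧ (m = 2 → ⌊β.im⌋ + 1 ≤ q) ∧
      (m = 3 → ⌊β.im⌋ + 1 ≤ q ∨ p ≤ ⌈β.re⌉ - 1)) :
    (m = 1 → 0 < ((p : ℂ) + (q : ℂ) * Complex.I - β).re ∧ 0 < ((p : ℂ) + (q : ℂ) * Complex.I - β).im) ∧
      (m = 2 → 0 < ((p : ℂ) + (q : ℂ) * Complex.I - β).im) ∧
      (m = 3 → 0 < ((p : ℂ) + (q : ℂ) * Complex.I - β).im ∨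
        ((p : ℂ) + (q : ℂ) * Complex.I - β).re < 0) := by
  have hre : ((p : ℂ) + (q : ℂ) * Complex.I - β).re = (p : ℝ) - β.re := by simp
  have him : ((p : ℂ) + (q : ℂ) * Complex.I - β).im = (q : ℝ) - β.im := by simp
  rw [hre, him]
  have kre : ⌊β.re⌋ + 1 ≤ p → 0 < (p : ℝ) - β.re := fun hp => by
    have h1 : ((⌊β.re⌋ + 1 : ℤ) : ℝ) ≤ p := by exact_mod_cast hp
    push_cast at h1
    linarith [Int.lt_floor_add_one β.re]
  have kim : ⌊β.im⌋ + 1 ≤ q → 0 < (q : ℝ) - β.im := fun hq => by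
    have h1 : ((⌊β.im⌋ + 1 : ℤ) : ℝ) ≤ q := by exact_mod_cast hq
    push_cast at h1
    linarith [Int.lt_floor_add_one β.im]
  have kre' : p ≤ ⌈β.re⌉ - 1 → (p : ℝ) - β.re < 0 := fun hp => by
    have h1 : (p : ℝ) ≤ ((⌈β.re⌉ - 1 : ℤ) : ℝ) := by exact_mod_cast hp
    push_cast at h1
    linarith [Int.ceil_lt_add_one β.re]
  obtain ⟨h1, h2, h3⟩ := h
  refine ⟨fun hm => ⟨kre (h1 hm).1, kim (h1 hm).2⟩, fun hm => kim (h2 hm), fun hm => ?_⟩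
  rcases h3 hm with h | h
  · exact Or.inl (kim h)
  · exact Or.inr (kre' h)

/-- **The unit step between two adjacent points of the lattice sector lies in the standard
sector** (convexity for one and two quadrants; for three quadrants an adjacent pair lies in a
common convex piece). [folklore] -/
theorem inSec_convexComb_of_latticeSector (m : ℕ) (β : ℂ) (p q p' q' : ℤ)
    (hadj : (p' = p + 1 ∧ q' = q) ∨ (p = p' + 1 ∧ q' = q) ∨ (q' = q + 1 ∧ p' = p) ∨
      (q = q' + 1 ∧ p' = p))
    (h : (m = 1 → ⌊β.re⌋ + 1 ≤ p ∧ ⌊β.im⌋ + 1 ≤ q) ∧ (m = 2 → ⌊β.im⌋ + 1 ≤ q) ∧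
      (m = 3 → ⌊β.im⌋ + 1 ≤ q ∨ p ≤ ⌈β.re⌉ - 1))
    (h' : (m = 1 → ⌊β.re⌋ + 1 ≤ p' ∧ ⌊β.im⌋ + 1 ≤ q') ∧ (m = 2 → ⌊β.im⌋ + 1 ≤ q') ∧
      (m = 3 → ⌊β.im⌋ + 1 ≤ q' ∨ p' ≤ ⌈β.re⌉ - 1))
    {t : ℝ} (ht0 : 0 ≤ t) (ht1 : t ≤ 1) :
    (m = 1 → 0 < ((1 - (t : ℂ)) * ((p : ℂ) + (q : ℂ) * Complex.I - β) +
        (t : ℂ) * ((p' : ℂ) + (q' : ℂ) * Complex.I - β)).re ∧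
      0 < ((1 - (t : ℂ)) * ((p : ℂ) + (q : ℂ) * Complex.I - β) +
        (t : ℂ) * ((p' : ℂ) + (q' : ℂ) * Complex.I - β)).im) ∧
    (m = 2 → 0 < ((1 - (t : ℂ)) * ((p : ℂ) + (q : ℂ) * Complex.I - β) +
        (t : ℂ) * ((p' : ℂ) + (q' : ℂ) * Complex.I - β)).im) ∧
    (m = 3 → 0 < ((1 - (t : ℂ)) * ((p : ℂ) + (q : ℂ) * Complex.I - β) +
        (t : ℂ) * ((p' : ℂ) + (q' : ℂ) * Complex.I - β)).im ∨
      ((1 - (t : ℂ)) * ((p : ℂ) + (q : ℂ) * Complex.I - β) +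
        (t : ℂ) * ((p' : ℂ) + (q' : ℂ) * Complex.I - β)).re < 0) := by
  have hre : ((1 - (t : ℂ)) * ((p : ℂ) + (q : ℂ) * Complex.I - β) +
      (t : ℂ) * ((p' : ℂ) + (q' : ℂ) * Complex.I - β)).re =
      (1 - t) * ((p : ℝ) - β.re) + t * ((p' : ℝ) - β.re) := by
    simp [sub_mul, mul_sub]
  have him : ((1 - (t : ℂ)) * ((p : ℂ) + (q : ℂ) * Complex.I - β) +
      (t : ℂ) * ((p' : ℂ) + (q' : ℂ) * Complex.I - β)).im =
      (1 - t) * ((q : ℝ) - β.im) + t * ((q' : ℝ) - β.im) := by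
    simp [sub_mul, mul_sub]
  rw [hre, him]
  -- convex combinations of two positive (negative) numbers
  have cpos : ∀ {x y : ℝ}, 0 < x → 0 < y → 0 < (1 - t) * x + t * y := fun {x y} hx hy => by
    rcases eq_or_lt_of_le ht0 with rfl | ht
    · simpa using hx
    · have : 0 ≤ (1 - t) * x := mul_nonneg (by linarith) hx.le
      nlinarith
  have cneg : ∀ {x y : ℝ}, x < 0 → y < 0 → (1 - t) * x + t * y < 0 := fun {x y} hx hy => by
    have := cpos (neg_pos.2 hx) (neg_pos.2 hy)
    linarith
  have kre : ∀ {p : ℤ}, ⌊β.re⌋ + 1 ≤ p → 0 < (p : ℝ) - β.re := fun {p} hp => by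
    have h1 : ((⌊β.re⌋ + 1 : ℤ) : ℝ) ≤ p := by exact_mod_cast hp
    push_cast at h1
    linarith [Int.lt_floor_add_one β.re]
  have kim : ∀ {q : ℤ}, ⌊β.im⌋ + 1 ≤ q → 0 < (q : ℝ) - β.im := fun {q} hq => by
    have h1 : ((⌊β.im⌋ + 1 : ℤ) : ℝ) ≤ q := by exact_mod_cast hq
    push_cast at h1
    linarith [Int.lt_floor_add_one β.im]
  have kre' : ∀ {p : ℤ}, p ≤ ⌈β.re⌉ - 1 → (p : ℝ) - β.re < 0 := fun {p} hp => by
    have h1 : (p : ℝ) ≤ ((⌈β.re⌉ - 1 : ℤ) : ℝ) := by exact_mod_cast hp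
    push_cast at h1
    linarith [Int.ceil_lt_add_one β.re]
  obtain ⟨h1, h2, h3⟩ := h
  obtain ⟨h1', h2', h3'⟩ := h'
  refine ⟨fun hm => ⟨cpos (kre (h1 hm).1) (kre (h1' hm).1), cpos (kim (h1 hm).2) (kim (h1' hm).2)⟩,
    fun hm => cpos (kim (h2 hm)) (kim (h2' hm)), fun hm => ?_⟩
  have a := h3 hm
  have a' := h3' hm
  by_cases hA : ⌊β.im⌋ + 1 ≤ q ∧ ⌊β.im⌋ + 1 ≤ q'
  · exact Or.inl (cpos (kim hA.1) (kim hA.2))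
  · by_cases hB : p ≤ ⌈β.re⌉ - 1 ∧ p' ≤ ⌈β.re⌉ - 1
    · exact Or.inr (cneg (kre' hB.1) (kre' hB.2))
    · exfalso
      rcases a with a | a <;> rcases a' with a' | a' <;> omega

/-! ### The frame map is affine -/

/-- Points of a segment, in the frame at `b` turned by `d`: a convex combination. [folklore] -/
theorem frame_convexComb {x y z b d : ℂ} (hz : z ∈ segment ℝ x y) :
    ∃ t : ℝ, 0 ≤ t ∧ t ≤ 1 ∧ (z - b) * d = (1 - (t : ℂ)) * ((x - b) * d) + (t : ℂ) * ((y - b) * d) ∧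
      dist z b ≤ max (dist x b) (dist y b) := by
  obtain ⟨a', t, ha', ht, hab, rfl⟩ := hz
  have ha'' : a' = 1 - t := by linarith
  subst ha''
  refine ⟨t, ht, by linarith, ?_, ?_⟩
  · simp only [Complex.real_smul, Complex.ofReal_sub, Complex.ofReal_one]
    ring
  · have : (1 - t) • x + t • y - b = (1 - t) • (x - b) + t • (y - b) := by
      simp only [Complex.real_smul, Complex.ofReal_sub, Complex.ofReal_one]
      ring
    rw [dist_eq_norm, this]
    calc ‖(1 - t) • (x - b) + t • (y - b)‖ ≤ ‖(1 - t) • (x - b)‖ + ‖t • (y - b)‖ := norm_add_le _ _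
      _ = (1 - t) * dist x b + t * dist y b := by
          rw [norm_smul, norm_smul, Real.norm_eq_abs, Real.norm_eq_abs, abs_of_nonneg (by linarith),
            abs_of_nonneg ht, dist_eq_norm, dist_eq_norm]
      _ ≤ (1 - t) * max (dist x b) (dist y b) + t * max (dist x b) (dist y b) :=
          add_le_add (mul_le_mul_of_nonneg_left (le_max_left _ _) (by linarith))
            (mul_le_mul_of_nonneg_left (le_max_right _ _) ht)
      _ = max (dist x b) (dist y b) := by ring

/-! ### Discrete-arc membership next to a boundary ray -/

/-- The frame coordinate has the norm of the displacement. [folklore] -/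
theorem norm_frame (z b : ℂ) (n : ℕ) : ‖(z - b) * (-Complex.I) ^ n‖ = dist z b := by
  rw [norm_mul, norm_pow, norm_neg, Complex.norm_I, one_pow, mul_one, dist_eq_norm]

/-- **A vertex of `Ω_δ` just beside a boundary ray lies on the discrete arc of any boundary set
containing the far part of the ray.** Frame `u = (z - b)(-i)^n`, `Ω` open, `δ > 0`, `0 ≤ λ`.
Let `P` contain every point `z` with `dist z b < r`, `u` real and `Re u > λ` (the ray beyond `λ`),
and let every point of `∂Ω ∖ P` within `r` of `b` satisfy `Re u ≤ 0` or `dist z b ≤ λ`. If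
`x ∈ Ω_δ` has a lattice neighbour `y` with `δy ∉ Ω`, and the frame coordinate `u` of `δx` has
`Re u ≥ λ + 2δ`, `|Im u| ≤ δ`, with `dist (δx) b + 2δ ≤ r`, then `x` is a discrete boundary
vertex and belongs to `discreteArc Ω δ P`: its foot `b + i^n Re u` on the ray is a point of `P`
within `|Im u| ≤ δ`, while every point of `∂Ω ∖ P` is at distance `≥ 2δ`. [folklore] -/
theorem mem_discreteArc_of_frame {Ω : Set ℂ} {δ : ℝ} (hδ : 0 < δ) {b : ℂ} {n : ℕ} {r lam : ℝ}
    (hlam : 0 ≤ lam) {P : Set ℂ} (hPne : (frontier Ω \ P).Nonempty)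
    (hPa : ∀ z, dist z b < r → ((z - b) * (-Complex.I) ^ n).im = 0 →
      lam < ((z - b) * (-Complex.I) ^ n).re → z ∈ P)
    (hPb : ∀ z ∈ frontier Ω, z ∉ P → dist z b < r →
      ((z - b) * (-Complex.I) ^ n).re ≤ 0 ∨ dist z b ≤ lam)
    {x y : Site 2} (hx : x ∈ meshDomain Ω δ) (hxy : (zdGraph 2).Adj x y)
    (hy : meshPoint δ y ∉ Ω)
    (hre : lam + 2 * δ ≤ ((meshPoint δ x - b) * (-Complex.I) ^ n).re)
    (him : |((meshPoint δ x - b) * (-Complex.I) ^ n).im| ≤ δ)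
    (hfit : dist (meshPoint δ x) b + 2 * δ ≤ r) :
    x ∈ discreteArc Ω δ P := by
  set px := meshPoint δ x with hpx
  set u := (px - b) * (-Complex.I) ^ n with hu
  have hxb : x ∈ meshBoundary Ω δ :=
    Literature.Probability.LatticeModels.mem_meshBoundary_of_adj_not_mem hx hxy fun h =>
      hy (Literature.Probability.LatticeModels.meshDomain_subset_meshVertices Ω δ h)
  rw [Literature.Probability.LatticeModels.mem_discreteArc_iff]
  refine ⟨hxb, ?_⟩
  have hnu : ‖u‖ = dist px b := norm_frame px b n
  -- the foot on the ray
  set f : ℂ := b + Complex.I ^ n * ((u.re : ℝ) : ℂ) with hf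
  have huf : (f - b) * (-Complex.I) ^ n = ((u.re : ℝ) : ℂ) := by
    rw [hf, add_sub_cancel_left, mul_comm (Complex.I ^ n), mul_assoc, ← mul_pow]
    simp
  have hure : 0 ≤ u.re := by linarith [hδ.le]
  have hfb : dist f b = u.re := by
    rw [← norm_frame f b n, huf, Complex.norm_real, Real.norm_eq_abs, abs_of_nonneg hure]
  have hfP : f ∈ P := by
    refine hPa f ?_ (by rw [huf]; simp) (by rw [huf]; simp; linarith)
    rw [hfb]
    have : u.re ≤ ‖u‖ := Complex.re_le_norm u
    linarith
  have hdist_f : dist px f = |u.im| := by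
    have h1 : (px - f) * (-Complex.I) ^ n = u - ((u.re : ℝ) : ℂ) := by
      rw [show px - f = (px - b) - (f - b) by ring, sub_mul, huf]
    have h2 : u - ((u.re : ℝ) : ℂ) = ((u.im : ℝ) : ℂ) * Complex.I :=
      Complex.ext (by simp) (by simp)
    rw [← norm_frame px f n, h1, h2, norm_mul, Complex.norm_I, mul_one, Complex.norm_real,
      Real.norm_eq_abs]
  have hup : infDist px P ≤ |u.im| := hdist_f ▸ infDist_le_dist_of_mem hfP
  refine hup.trans (him.trans ?_)
  -- everything off `P` on the frontier is at distance `≥ 2δ ≥ δ`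
  refine (le_infDist hPne).2 fun z hz => ?_
  obtain ⟨hzf, hzP⟩ := hz
  by_cases hzr : dist z b < r
  · rcases hPb z hzf hzP hzr with h | h
    · -- behind `b`: the real parts differ by at least `Re u`
      have h1 : ‖(px - z) * (-Complex.I) ^ n‖ = dist px z := norm_frame px z n
      have h2 : (px - z) * (-Complex.I) ^ n = u - (z - b) * (-Complex.I) ^ n := by
        rw [hu, ← sub_mul]; ring
      have h3 : u.re - ((z - b) * (-Complex.I) ^ n).re ≤ ‖u - (z - b) * (-Complex.I) ^ n‖ := by
        have := Complex.re_le_norm (u - (z - b) * (-Complex.I) ^ n)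
        rwa [Complex.sub_re] at this
      rw [← h1, h2]
      linarith
    · -- close to `b`
      have h1 : dist px b ≤ dist px z + dist z b := dist_triangle _ _ _
      have h2 : u.re ≤ ‖u‖ := Complex.re_le_norm u
      linarith
  · push Not at hzr
    have h1 : dist z b ≤ dist z px + dist px b := dist_triangle _ _ _
    rw [dist_comm z px] at h1
    linarith

end Summit.CriticalPhenomena.CardyFormulaZ2.Cruxes.RectilinearCardy.ExcursionKernelCovariance

end
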